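import Literature.Barriers.RiemannHypothesis.SubsetPrimeTowers
import Literature.Barriers.RiemannHypothesis.SubsetPrimeRealZeros
import Literature.NumberTheory.BeurlingPrimes.IntegerContinuation
import Literature.NumberTheory.LFunctions.ZetaRealAxis
import Literature.NumberTheory.BeurlingPrimes.OneLine

/-!
# Subset prime towers — the DELETION WINDOW `β₀(α)`: RH-free structure and the RH edge (companion record)

Kernel companion of the TYPED FRONTIER RECORD «DELETION WINDOW β₀(α)» whose TEXT is in the tree at
`SubsetPrimeTowers.lean` `* scope_caveats:` (p684277) — not repeated here. Content (W-06 cycle 2, cell C5′,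
rh-idea-6 g11 SketchV2 f0adb955720efdaa, filer's cut; critic rh-split-ref-2 g11 2026-08-29T00:41:02Z / 00:50:51Z,
desk rh-split-ref g15 00:42:03Z / 01:03:14Z): for kept systems `P ⊊ ℙ` (deletion `D = ℙ ∖ P`), LEMMA B
`Z = ζ · exp(−G_D)` right of the deleted abscissa, so a NEW zero (`Z ρ = 0 ∧ ζ ρ ≠ 0`) forces the deleted Euler
logarithm to diverge at every `σ < Re ρ` [cite: MontgomeryVaughan2007, Lemma 15.1]; LEMMA A: a deleted log-abscissa
`> A ≥ β` forces a zero of every continuation in `A < Re s < 1` (Landau); the ψ-form bridge by partial summation;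
the RH edge `¬ NewZeroCost α β₀` for `β₀ > 2α/(α+2)`, `1/2 < α < 2/3` from the tree's BDR §5 witness
[cite: BrouckeDebruyneRevesz2023, Theorem 1.3]; the class forms admitting `ℙ` (`WindowNoZero`, `AnyZeroCost`) are
RiemannHypothesis from below; the hypotheses are void at `ℙ` and for thin deletions. A FRONTIER question of Beurling
theory carrying 0 bits toward `Re ρ(ζ)` [cite: Hilberdink2005, Thm. 1]. Nothing here bears on the truth of RH.
-/

noncomputable section

open Complex Filter Set Topology
open Literature.Barriers.RiemannHypothesis Literature.NumberTheory.BeurlingPrimes Literature.NumberTheory.LFunctions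

namespace Literature.Barriers.RiemannHypothesis.DeletionWindow

/-! ## Kept (deletion) systems -/

/-- `P` is a KEPT system: it enumerates a multiplicity-one sub-sequence of the rational primes. [cite: BrouckeDebruyneRevesz2023, §5] -/
def IsKept (P : BeurlingPrimes) : Prop :=
  ∃ f : ℕ → ℕ, StrictMono f ∧ ∀ j : ℕ, P.prime j = (ratPrime (f j) : ℝ)

/-- Kernel helper of the deletion-window record. [cite: BrouckeDebruyneRevesz2023, §5] -/
theorem isKept_ratPrimes : IsKept ratPrimes := ⟨id, strictMono_id, fun _ ↦ rfl⟩

/-- Kernel helper of the deletion-window record. [cite: BrouckeDebruyneRevesz2023, §5] -/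
theorem isKept_keptSystem (S : Set ℕ) (hT : (keptIdx S).Infinite) : IsKept (keptSystem S hT) :=
  ⟨Nat.nth (fun i ↦ i ∈ keptIdx S), Nat.nth_strictMono (by simpa [Set.setOf_mem_eq] using hT), fun _ ↦ rfl⟩

/-- `ζ` itself is a continuation of `ζ_ℙ` to every punctured half-plane (Mathlib's `riemannZeta` is entire off `1`). [folklore] -/
private theorem ratPrimes_isZetaContinuation (β : ℝ) : ratPrimes.IsZetaContinuation β riemannZeta :=
  (BeurlingPrimes.isZetaContinuation_iff _ _ _).2
    ⟨fun _ hs ↦ (zeta_ratPrimes hs).symm, fun _ hs ↦ (differentiableAt_riemannZeta hs.2).differentiableWithinAt⟩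

/-- For `P = ℙ` EVERY continuation is `ζ` on its half-plane: ℙ has NO new zeros (the ¬RH branch of S3♯ cannot
instantiate reading R2(b)). [folklore] -/
private theorem ratPrimes_no_new_zero {β : ℝ} {Z : ℂ → ℂ} (hZ : ratPrimes.IsZetaContinuation β Z) {ρ : ℂ}
    (hρ : β < ρ.re) (hρ1 : ρ ≠ 1) : Z ρ = riemannZeta ρ :=
  hZ.eqOn (ratPrimes_isZetaContinuation β) ⟨hρ, hρ1⟩

/-! ## Reading R1 — a window statement over a class `R` of systems containing `ℙ` -/

/-- R1(R, α, β₀): for every system in the class `R` with density `a > 0`, integer error exponent `β < β₀` and a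
continuation `Z` of `ζ_P` to `{Re s > β} ∖ {1}`: no zero with `α ≤ Re s < 1`. [cite: BrouckeDebruyneRevesz2023, Theorem 1.3] -/
def WindowNoZero (R : BeurlingPrimes → Prop) (α β₀ : ℝ) : Prop :=
  ∀ (P : BeurlingPrimes) (a β : ℝ) (Z : ℂ → ℂ), R P → 0 < a → β < β₀ → P.IntErrorLE a β →
    P.IsZetaContinuation β Z → ∀ s : ℂ, α ≤ s.re → s.re < 1 → Z s ≠ 0

/-- R1 at one `α` already gives `ζ ≠ 0` on `α ≤ Re s < 1` whenever `ℙ ∈ R` and `β₀ > 0` (instance `P = ℙ`, `β = 0`). [folklore] -/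
private theorem zeta_ne_zero_of_windowNoZero {R : BeurlingPrimes → Prop} (hR : R ratPrimes) {α β₀ : ℝ} (hβ₀ : 0 < β₀)
    (h : WindowNoZero R α β₀) {s : ℂ} (hα : α ≤ s.re) (hs1 : s.re < 1) : riemannZeta s ≠ 0 :=
  h ratPrimes 1 0 riemannZeta hR one_pos hβ₀ (ratPrimes_intErrorLE le_rfl) (ratPrimes_isZetaContinuation 0) s hα hs1

/-- **R1 is a COSTUME from below**: if `ℙ ∈ R` and `β₀ > 0`, then `(∀ α ∈ (1/2,1), R1(R, α, β₀)) ⟹ RH`. [cite: BrouckeDebruyneRevesz2023, Theorem 1.3] -/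
theorem riemannHypothesis_of_windowNoZero {R : BeurlingPrimes → Prop} (hR : R ratPrimes) {β₀ : ℝ}
    (hβ₀ : 0 < β₀) (h : ∀ α : ℝ, 1 / 2 < α → α < 1 → WindowNoZero R α β₀) : RiemannHypothesis := by
  by_contra hRH
  obtain ⟨ρ, hζ, -, hhalf⟩ := exists_zero_half_lt_re_of_not_riemannHypothesis hRH
  have hρ1 : ρ.re < 1 := by
    by_contra h1
    exact riemannZeta_ne_zero_of_one_le_re (not_lt.1 h1) hζ
  exact zeta_ne_zero_of_windowNoZero hR hβ₀ (h ρ.re hhalf hρ1) le_rfl hρ1 hζ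

/-- The three classes of the director's reading 1 all contain `ℙ`. [cite: BrouckeDebruyneRevesz2023, Theorem 1.3] -/
theorem riemannHypothesis_of_windowNoZero_kept {β₀ : ℝ} (hβ₀ : 0 < β₀)
    (h : ∀ α : ℝ, 1 / 2 < α → α < 1 → WindowNoZero IsKept α β₀) : RiemannHypothesis :=
  riemannHypothesis_of_windowNoZero isKept_ratPrimes hβ₀ h

/-- Kernel helper of the deletion-window record. [folklore] -/
private theorem riemannHypothesis_of_windowNoZero_all {β₀ : ℝ} (hβ₀ : 0 < β₀)
    (h : ∀ α : ℝ, 1 / 2 < α → α < 1 → WindowNoZero (fun _ ↦ True) α β₀) : RiemannHypothesis :=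
  riemannHypothesis_of_windowNoZero trivial hβ₀ h

/-! ## Reading R2 — proper deletions, NEW zero only -/

/-- R2(a), the ψ_S-form at fixed `(α, β₀)`: deleting a set of primes of dimension `≥ α`
(`ψ − ψ_P ≥ c x^α` frequently) costs integer error exponent `β ≥ β₀`.
(= the body of `RhIdea5.W06C5.DeletionUncertainty`, C5Ladder.lean :343, at fixed `α, β₀`.) [cite: BrouckeDebruyneRevesz2023, §5] -/
def DimCost (α β₀ : ℝ) : Prop :=
  ∀ (P : BeurlingPrimes) (f : ℕ → ℕ) (a β : ℝ), StrictMono f → (∀ j : ℕ, P.prime j = (ratPrime (f j) : ℝ)) →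
    (∃ c : ℝ, 0 < c ∧ ∃ᶠ x in atTop, c * x ^ α ≤ ratPrimes.chebyshevPsi x - P.chebyshevPsi x) →
    0 < a → P.IntErrorLE a β → β₀ ≤ β

/-- T6 verbatim (rh-idea-5 g10): for every `α ∈ (1/2, 1)` some `β₀(α) > 0` works. [cite: Hilberdink2005, Thm. 1] -/
def DeletionUncertainty : Prop :=
  ∀ α : ℝ, 1 / 2 < α → α < 1 → ∃ β₀ : ℝ, 0 < β₀ ∧ DimCost α β₀

/-- R2(b), the NEW-ZERO-COST form: a kept system with density `a > 0`, `N_P = a x + O(x^β)`, a continuation `Z` of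
`ζ_P` to `{Re s > β} ∖ {1}` and a zero `ρ` of `Z` with `β < Re ρ`, `α ≤ Re ρ < 1` which is NOT a zero of `ζ`
(a NEW zero) has `β ≥ β₀`. [cite: BrouckeDebruyneRevesz2023, §5] -/
def NewZeroCost (α β₀ : ℝ) : Prop :=
  ∀ (P : BeurlingPrimes) (f : ℕ → ℕ) (a β : ℝ) (Z : ℂ → ℂ) (ρ : ℂ), StrictMono f →
    (∀ j : ℕ, P.prime j = (ratPrime (f j) : ℝ)) → 0 < a → P.IntErrorLE a β → P.IsZetaContinuation β Z →
    β < ρ.re → α ≤ ρ.re → ρ.re < 1 → Z ρ = 0 → riemannZeta ρ ≠ 0 → β₀ ≤ β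

/-- R2(c), the CARELESS form (any zero, new or inherited from `ζ`). [cite: BrouckeDebruyneRevesz2023, Theorem 1.3] -/
def AnyZeroCost (α β₀ : ℝ) : Prop :=
  ∀ (P : BeurlingPrimes) (f : ℕ → ℕ) (a β : ℝ) (Z : ℂ → ℂ) (ρ : ℂ), StrictMono f →
    (∀ j : ℕ, P.prime j = (ratPrime (f j) : ℝ)) → 0 < a → P.IntErrorLE a β → P.IsZetaContinuation β Z →
    β < ρ.re → α ≤ ρ.re → ρ.re < 1 → Z ρ = 0 → β₀ ≤ β

/-- Kernel helper of the deletion-window record. [folklore] -/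
private theorem newZeroCost_of_anyZeroCost {α β₀ : ℝ} (h : AnyZeroCost α β₀) : NewZeroCost α β₀ :=
  fun P f a β Z ρ hf hP ha hN hZ hβ hα h1 h0 _ ↦ h P f a β Z ρ hf hP ha hN hZ hβ hα h1 h0

/-- Monotonicity: the cost statements weaken as `α` grows and as `β₀` shrinks. [folklore] -/
private theorem NewZeroCost.mono {α α' β₀ β₀' : ℝ} (h : NewZeroCost α β₀) (hα : α ≤ α') (hβ : β₀' ≤ β₀) :
    NewZeroCost α' β₀' :=
  fun P f a β Z ρ hf hP ha hN hZ hβρ hαρ h1 h0 hζ ↦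
    (hβ.trans (h P f a β Z ρ hf hP ha hN hZ hβρ (hα.trans hαρ) h1 h0 hζ))

/-- Kernel helper of the deletion-window record. [folklore] -/
private theorem DimCost.mono {α α' β₀ β₀' : ℝ} (h : DimCost α β₀) (hα : α ≤ α') (hβ : β₀' ≤ β₀) : DimCost α' β₀' := by
  intro P f a β hf hP hψ ha hN
  refine hβ.trans (h P f a β hf hP ?_ ha hN)
  obtain ⟨c, hc, hfr⟩ := hψ
  refine ⟨c, hc, ?_⟩
  refine (hfr.and_eventually (eventually_ge_atTop 1)).mono fun x hx ↦ ?_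
  exact le_trans (mul_le_mul_of_nonneg_left (Real.rpow_le_rpow_of_exponent_le hx.2 hα) hc.le) hx.1

/-- **The careless form is a COSTUME**: `β₀ > 0` and `(∀ α ∈ (1/2,1), AnyZeroCost α β₀)` ⟹ RH
(instance `P = ℙ`, `f = id`, `β = 0`, `Z = ζ`, `ρ` = an off-line zero). [cite: BrouckeDebruyneRevesz2023, Theorem 1.3] -/
theorem riemannHypothesis_of_anyZeroCost {β₀ : ℝ} (hβ₀ : 0 < β₀)
    (h : ∀ α : ℝ, 1 / 2 < α → α < 1 → AnyZeroCost α β₀) : RiemannHypothesis := by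
  by_contra hRH
  obtain ⟨ρ, hζ, h0, hhalf⟩ := exists_zero_half_lt_re_of_not_riemannHypothesis hRH
  have hρ1 : ρ.re < 1 := by
    by_contra h1
    exact riemannZeta_ne_zero_of_one_le_re (not_lt.1 h1) hζ
  have := h ρ.re hhalf hρ1 ratPrimes id 1 0 riemannZeta ρ strictMono_id (fun _ ↦ rfl) one_pos
    (ratPrimes_intErrorLE le_rfl) (ratPrimes_isZetaContinuation 0) h0 le_rfl hρ1 hζ
  linarith

/-- … whereas in the NEW-zero form the instance `P = ℙ` is VOID: with `P = ℙ` the hypotheses of `NewZeroCost` are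
contradictory (`Z ρ = ζ ρ` by uniqueness of the continuation), so ℙ — the ¬RH branch of S3♯
(`subPrimeFiniteTowerBlind_holds`) — says nothing about `NewZeroCost`; only PROPER deletions are in play. [cite: BrouckeDebruyneRevesz2023, §5] -/
theorem newZeroCost_hypotheses_void_at_ratPrimes {β : ℝ} {Z : ℂ → ℂ} {ρ : ℂ}
    (hZ : ratPrimes.IsZetaContinuation β Z) (hβρ : β < ρ.re) (hρ1 : ρ.re < 1) (h0 : Z ρ = 0)
    (hζ : riemannZeta ρ ≠ 0) : False := by
  have hρne : ρ ≠ 1 := by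
    rintro rfl
    simp at hρ1
  exact hζ ((ratPrimes_no_new_zero hZ hβρ hρne).symm.trans h0)

/-! ## The upper edge of the window under RH (BDR 2023 §5 from the tree) -/

/-- **Under RH, `β₀(α) ≤ 2α/(α+2)` in the NEW-zero reading**: `NewZeroCost α β₀` FAILS for every `β₀ > 2α/(α+2)`,
`1/2 < α < 2/3` — witness: the BDR intermediate system `ℙ ∖ 𝒫_𝒮` (`exists_keptSystem_window_zero_of_riemannHypothesis`),
whose planted zero `Z α = 0` is REAL with `ζ(α) ≠ 0` (`riemannZeta_ofReal_ne_zero_of_pos_of_lt_one`), hence NEW.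
[BDR arXiv:2309.01567 Thm 1.3 / §5 pp. 15–17, UNDER RH] [cite: BrouckeDebruyneRevesz2023, Theorem 1.3] -/
theorem not_newZeroCost_of_riemannHypothesis (hRH : RiemannHypothesis) {α β₀ : ℝ} (hα : 1 / 2 < α)
    (hα23 : α < 2 / 3) (hβ₀ : 2 * α / (α + 2) < β₀) : ¬ NewZeroCost α β₀ := by
  intro h
  obtain ⟨S, hT, a, Z, ha, -, hN', hZ1, hZd, hZα⟩ :=
    exists_keptSystem_window_zero_of_riemannHypothesis hRH hα hα23
  set γ : ℝ := 2 * α / (α + 2) with hγ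
  have hγα : γ < α := by rw [hγ, div_lt_iff₀ (by linarith)]; nlinarith
  have hγgt : α / 2 < γ := by rw [hγ, lt_div_iff₀ (by linarith)]; nlinarith
  set ε : ℝ := (min β₀ α - γ) / 2 with hε
  have hmin : γ < min β₀ α := lt_min hβ₀ hγα
  have hε0 : 0 < ε := by rw [hε]; linarith
  set β : ℝ := γ + ε with hβdef
  have hββ₀ : β < β₀ := by
    have := min_le_left β₀ α; rw [hβdef, hε]; linarith
  have hβα : β < α := by
    have := min_le_right β₀ α; rw [hβdef, hε]; linarith
  obtain ⟨C, hC⟩ := hN' ε hε0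
  have hN : (keptSystem S hT).IntErrorLE a β := ⟨C, fun x hx ↦ by rw [hβdef]; exact hC x hx⟩
  have hZ : (keptSystem S hT).IsZetaContinuation β Z :=
    (BeurlingPrimes.isZetaContinuation_iff _ _ _).2 ⟨hZ1, hZd.mono fun s hs ↦ ⟨by linarith [hs.1], hs.2⟩⟩
  have hζα : riemannZeta (α : ℂ) ≠ 0 := riemannZeta_ofReal_ne_zero_of_pos_of_lt_one α (by linarith) (by linarith)
  have := h (keptSystem S hT) (Nat.nth (fun i ↦ i ∈ keptIdx S)) a β Z (α : ℂ)
    (Nat.nth_strictMono (by simpa [Set.setOf_mem_eq] using hT)) (fun _ ↦ rfl) ha hN hZ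
    (by simpa only [ofReal_re] using hβα) (by simp only [ofReal_re]; exact le_rfl)
    (by simp only [ofReal_re]; linarith) hZα hζα
  linarith

/-- Packaging: under RH the NEW-zero deletion floor satisfies `β₀(α) ≤ 2α/(α+2)` on `(1/2, 2/3)`; as `α ↓ 1/2` this
is the BDR floor `2/5`.  (Unconditionally NO upper edge `< 1/2`… and NO lower edge `> 0` is in the tree or in print.) [folklore] -/
private theorem newZeroCost_le_of_riemannHypothesis (hRH : RiemannHypothesis) {α β₀ : ℝ} (hα : 1 / 2 < α)
    (hα23 : α < 2 / 3) (h : NewZeroCost α β₀) : β₀ ≤ 2 * α / (α + 2) := by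
  by_contra hlt
  exact not_newZeroCost_of_riemannHypothesis hRH hα hα23 (not_le.1 hlt) h

/-! ## LEMMA B, kernel form (RH-free): a NEW zero needs deleted mass — `Z = ζ · exp(−G_D)` right of the abscissa -/

/-- The deleted Euler logarithm `G_D(s) = Σ_{p ∉ range f} Σ_{k ≥ 1} p^{−ks}/k` converges absolutely at the real point
`σ` (for `σ > 1/2` this is `Σ_{p deleted} p^{−σ} < ∞`: the deleted set has "dimension `≤ σ`"). [cite: MontgomeryVaughan2007, Lemma 15.1] -/
def DelLogSummable (f : ℕ → ℕ) (σ : ℝ) : Prop :=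
  Summable fun i ↦ delCoeff f i * Real.exp (-(delFreq f i * σ))

/-- Kernel helper of the deletion-window record. [folklore] -/
private theorem delCoeff_nonneg' (f : ℕ → ℕ) (i : ↥(Set.range f)ᶜ × ℕ) : 0 ≤ delCoeff f i := by
  unfold delCoeff; positivity

/-- Kernel helper of the deletion-window record. [folklore] -/
private theorem delFreq_nonneg' (f : ℕ → ℕ) (i : ↥(Set.range f)ᶜ × ℕ) : 0 ≤ delFreq f i := by
  unfold delFreq
  refine mul_nonneg (by positivity) (Real.log_nonneg ?_)
  exact_mod_cast (prime_ratPrime (i.1 : ℕ)).one_lt.le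

/-- **`Z = ζ · e^{−G_D}` on `{Re s > max(β, σ₀)} ∖ {1}`** (RH-free): for a kept system whose deleted Euler log
converges at `σ₀`, every continuation `Z` of `ζ_P` to `Re s > β` factors through `ζ` there (identity theorem on the
preconnected punctured half-plane, from `zeta_div_riemannZeta_eq` on `Re s > 2`). [cite: MontgomeryVaughan2007, Lemma 15.1] -/
theorem Z_eq_zeta_mul_exp {P : BeurlingPrimes} {f : ℕ → ℕ} (hf : StrictMono f)
    (hP : ∀ j : ℕ, P.prime j = (ratPrime (f j) : ℝ)) {β σ₀ : ℝ} {Z : ℂ → ℂ} (hZ : P.IsZetaContinuation β Z)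
    (hσ : DelLogSummable f σ₀) {s : ℂ} (hβs : β < s.re) (hσs : σ₀ < s.re) (hs1 : s ≠ 1) :
    Z s = riemannZeta s * Complex.exp (-Landau.genDirichlet (delCoeff f) (delFreq f) s) := by
  set η : ℝ := max β σ₀ with hη
  set U : Set ℂ := {s : ℂ | η < s.re ∧ s ≠ 1} with hU
  have hUo : IsOpen U := (isOpen_lt continuous_const continuous_re).inter isOpen_ne
  have hG : DifferentiableOn ℂ (Landau.genDirichlet (delCoeff f) (delFreq f)) {s : ℂ | σ₀ < s.re} :=
    Landau.differentiableOn_genDirichlet (delCoeff_nonneg' f) (delFreq_nonneg' f) hσ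
  have hF : DifferentiableOn ℂ
      (fun s ↦ riemannZeta s * Complex.exp (-Landau.genDirichlet (delCoeff f) (delFreq f) s)) U := by
    intro s hs
    have hs' : σ₀ < s.re := lt_of_le_of_lt (le_max_right _ _) hs.1
    have hGs : DifferentiableAt ℂ (Landau.genDirichlet (delCoeff f) (delFreq f)) s :=
      hG.differentiableAt ((isOpen_lt continuous_const continuous_re).mem_nhds hs')
    exact ((differentiableAt_riemannZeta hs.2).mul hGs.neg.cexp).differentiableWithinAt
  have hZU : DifferentiableOn ℂ Z U := hZ.2.mono fun s hs ↦ ⟨lt_of_le_of_lt (le_max_left _ _) hs.1, hs.2⟩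
  have haZ : AnalyticOnNhd ℂ Z U := hZU.analyticOnNhd hUo
  have haF : AnalyticOnNhd ℂ
      (fun s ↦ riemannZeta s * Complex.exp (-Landau.genDirichlet (delCoeff f) (delFreq f) s)) U :=
    hF.analyticOnNhd hUo
  -- a base point far to the right and agreement on `Re s > max(η, 2)`
  set z₀ : ℂ := ((max η 2 + 1 : ℝ) : ℂ) with hz₀
  have hz₀re : z₀.re = max η 2 + 1 := by simp [hz₀]
  have hz₀U : z₀ ∈ U := by
    refine ⟨by rw [hz₀re]; linarith [le_max_left η 2], fun h ↦ ?_⟩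
    have := congrArg Complex.re h
    rw [hz₀re, one_re] at this
    linarith [le_max_right η 2]
  have hev : Z =ᶠ[𝓝 z₀] fun s ↦ riemannZeta s * Complex.exp (-Landau.genDirichlet (delCoeff f) (delFreq f) s) := by
    have h2lt : (2 : ℝ) < z₀.re := by rw [hz₀re]; linarith [le_max_right η 2]
    filter_upwards [(isOpen_lt continuous_const continuous_re).mem_nhds h2lt] with s hs
    have hs2 : (2 : ℝ) < s.re := hs
    have hζ : riemannZeta s ≠ 0 := riemannZeta_ne_zero_of_one_lt_re (by linarith)
    rw [hZ.1 s (by linarith), ← zeta_div_riemannZeta_eq hf hP hs2, mul_div_cancel₀ _ hζ]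
  have hsU : s ∈ U := ⟨max_lt hβs hσs, hs1⟩
  exact haZ.eqOn_of_preconnected_of_eventuallyEq haF (isPreconnected_puncturedHalfPlane η) hz₀U hev hsU

/-- **LEMMA B (kernel, RH-free): a zero of `Z` right of the deleted abscissa is a zero of `ζ`.**  Hence a NEW zero
`ρ` (`ζ ρ ≠ 0`) of a kept system forces `Σ_{p deleted} p^{−σ} = ∞` for every `σ < Re ρ` with `σ ≥ β`… stated as:
convergence at `σ₀ < Re ρ` and `β < Re ρ` exclude new zeros at `ρ`. [folklore] -/
private theorem zeta_eq_zero_of_Z_eq_zero {P : BeurlingPrimes} {f : ℕ → ℕ} (hf : StrictMono f)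
    (hP : ∀ j : ℕ, P.prime j = (ratPrime (f j) : ℝ)) {β σ₀ : ℝ} {Z : ℂ → ℂ} (hZ : P.IsZetaContinuation β Z)
    (hσ : DelLogSummable f σ₀) {ρ : ℂ} (hβρ : β < ρ.re) (hσρ : σ₀ < ρ.re) (hρ1 : ρ ≠ 1) (h0 : Z ρ = 0) :
    riemannZeta ρ = 0 := by
  have h := Z_eq_zeta_mul_exp hf hP hZ hσ hβρ hσρ hρ1
  rw [h0] at h
  exact (mul_eq_zero.1 h.symm).resolve_right (Complex.exp_ne_zero _)

/-- Contrapositive: **a NEW zero needs deleted mass** — if `Z ρ = 0`, `ζ ρ ≠ 0`, `Re ρ > β`, then the deleted Euler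
logarithm DIVERGES at every `σ₀ < Re ρ` (the deleted set has dimension `≥ Re ρ`).  RH-free. [cite: MontgomeryVaughan2007, Lemma 15.1] -/
theorem not_delLogSummable_of_new_zero {P : BeurlingPrimes} {f : ℕ → ℕ} (hf : StrictMono f)
    (hP : ∀ j : ℕ, P.prime j = (ratPrime (f j) : ℝ)) {β : ℝ} {Z : ℂ → ℂ} (hZ : P.IsZetaContinuation β Z)
    {ρ : ℂ} (hβρ : β < ρ.re) (hρ1 : ρ.re < 1) (h0 : Z ρ = 0) (hζ : riemannZeta ρ ≠ 0) {σ₀ : ℝ}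
    (hσρ : σ₀ < ρ.re) : ¬ DelLogSummable f σ₀ := fun hσ ↦
  hζ (zeta_eq_zero_of_Z_eq_zero hf hP hZ hσ hβρ hσρ (fun h ↦ by rw [h, one_re] at hρ1; exact lt_irrefl _ hρ1) h0)

/-- So THIN deletions are free: a kept system whose deleted Euler log converges at some `σ₀ < α` can carry no new zero
with `Re ρ ≥ α`, and `NewZeroCost α β₀` holds on that sub-class for EVERY `β₀` (vacuously).  In particular finite
deletions and every `S` with `Σ_{p∈S} p^{−σ₀} < ∞`, `σ₀ < α`, can never refute reading R2(b); neither can `ℙ`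
(`newZeroCost_hypotheses_void_at_ratPrimes`).  The frontier statement is about deleted sets of dimension `≥ α`. [cite: MontgomeryVaughan2007, Lemma 15.1] -/
theorem newZero_hypotheses_void_of_thin {P : BeurlingPrimes} {f : ℕ → ℕ} (hf : StrictMono f)
    (hP : ∀ j : ℕ, P.prime j = (ratPrime (f j) : ℝ)) {β σ₀ α : ℝ} (hσα : σ₀ < α) (hσ : DelLogSummable f σ₀)
    {Z : ℂ → ℂ} (hZ : P.IsZetaContinuation β Z) {ρ : ℂ} (hβρ : β < ρ.re) (hαρ : α ≤ ρ.re) (hρ1 : ρ.re < 1)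
    (h0 : Z ρ = 0) (hζ : riemannZeta ρ ≠ 0) : False :=
  not_delLogSummable_of_new_zero hf hP hZ hβρ hρ1 h0 hζ (lt_of_lt_of_le hσα hαρ) hσ

/-! ## LEMMA A, kernel half-plane form (RH-free): DELETED DIMENSION FORCES ZEROS of the kept zeta function -/

/-- Base point: the deleted Euler logarithm converges absolutely at `σ = 2` (the tree's private `summable_del_two`,
reproduced verbatim for the scratch file). [folklore] -/
private theorem delLogSummable_two (f : ℕ → ℕ) : DelLogSummable f 2 := by
  unfold DelLogSummable
  -- `q n = p_n^{−2} = exp(−2 log p_n) ≤ 1/4`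
  set q : ↥(Set.range f)ᶜ → ℝ := fun n ↦ Real.exp (-(2 * Real.log (ratPrime (n : ℕ)))) with hq
  have hq0 : ∀ n, 0 ≤ q n := fun n ↦ (Real.exp_pos _).le
  have hq4 : ∀ n, q n ≤ 1 / 4 := by
    intro n
    have h2 : (2 : ℝ) ≤ ratPrime (n : ℕ) := by exact_mod_cast (prime_ratPrime (n : ℕ)).two_le
    have hlog : Real.log 2 ≤ Real.log (ratPrime (n : ℕ)) := Real.log_le_log (by norm_num) h2
    have : q n ≤ Real.exp (-(2 * Real.log 2)) := by
      rw [hq]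
      exact Real.exp_le_exp.2 (by linarith)
    refine this.trans (le_of_eq ?_)
    rw [show -(2 * Real.log 2) = Real.log ((2 : ℝ) ^ 2)⁻¹ by
      rw [Real.log_inv, Real.log_pow]; push_cast; ring, Real.exp_log (by positivity)]
    norm_num
  have hF0 : 0 ≤ fun i ↦ delCoeff f i * Real.exp (-(delFreq f i * 2)) :=
    fun i ↦ mul_nonneg (delCoeff_nonneg' f i) (Real.exp_pos _).le
  -- termwise bound `F(n,k) ≤ q n * (1/4)^k`
  have hterm : ∀ (n : ↥(Set.range f)ᶜ) (k : ℕ),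
      delCoeff f (n, k) * Real.exp (-(delFreq f (n, k) * 2)) ≤ q n * (1 / 4) ^ k := by
    intro n k
    have hexp : Real.exp (-(delFreq f (n, k) * 2)) = q n ^ (k + 1) := by
      rw [hq]
      simp only [delFreq]
      rw [← Real.exp_nat_mul]
      congr 1
      push_cast
      ring
    have hcoef : delCoeff f (n, k) ≤ 1 := by
      simp only [delCoeff]
      rw [div_le_one (by positivity)]
      linarith [(Nat.cast_nonneg k : (0 : ℝ) ≤ k)]
    calc delCoeff f (n, k) * Real.exp (-(delFreq f (n, k) * 2))
        ≤ 1 * q n ^ (k + 1) := by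
          rw [hexp]
          exact mul_le_mul_of_nonneg_right hcoef (pow_nonneg (hq0 n) _)
      _ = q n * q n ^ k := by ring
      _ ≤ q n * (1 / 4) ^ k :=
          mul_le_mul_of_nonneg_left (pow_le_pow_left₀ (hq0 n) (hq4 n) k) (hq0 n)
  have hgeo : Summable fun k : ℕ ↦ (1 / 4 : ℝ) ^ k :=
    summable_geometric_of_lt_one (by norm_num) (by norm_num)
  have hinner : ∀ n : ↥(Set.range f)ᶜ, Summable fun k : ℕ ↦
      delCoeff f (n, k) * Real.exp (-(delFreq f (n, k) * 2)) := fun n ↦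
    (hgeo.mul_left (q n)).of_nonneg_of_le (fun k ↦ hF0 (n, k)) (hterm n)
  -- the outer sum: `∑_k F(n,k) ≤ q n * 4/3`, and `∑_n q n < ∞`
  have hq_summ : Summable q := by
    have h := (summable_ratPrimes_prime_rpow (σ := 2) (by norm_num)).subtype (Set.range f)ᶜ
    refine h.congr fun n ↦ ?_
    simp only [Function.comp_apply, ratPrimes_prime, hq]
    rw [Real.rpow_def_of_pos (by exact_mod_cast (prime_ratPrime (n : ℕ)).pos)]
    congr 1
    ring
  have houter : Summable fun n : ↥(Set.range f)ᶜ ↦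
      ∑' k : ℕ, delCoeff f (n, k) * Real.exp (-(delFreq f (n, k) * 2)) := by
    refine (hq_summ.mul_right (∑' k : ℕ, (1 / 4 : ℝ) ^ k)).of_nonneg_of_le
      (fun n ↦ tsum_nonneg fun k ↦ hF0 (n, k)) fun n ↦ ?_
    calc ∑' k : ℕ, delCoeff f (n, k) * Real.exp (-(delFreq f (n, k) * 2))
        ≤ ∑' k : ℕ, q n * (1 / 4 : ℝ) ^ k :=
          (hinner n).tsum_le_tsum (hterm n) (hgeo.mul_left (q n))
      _ = q n * ∑' k : ℕ, (1 / 4 : ℝ) ^ k := tsum_mul_left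
  exact (summable_prod_of_nonneg hF0).2 ⟨hinner, houter⟩

/-- **LEMMA A (kernel, RH-free, half-plane form): a ZERO-FREE continuation past `A` bounds the deleted dimension by `A`.**
For a kept system `P` (`λ_j = q_{f j}`) with density `a > 0`, `N_P = a x + O(x^β)`, `β < 1`, and a continuation `Z` of
`ζ_P` to `{Re s > β} ∖ {1}` which has NO ZERO on `{A < Re s} ∖ {1}` (`β ≤ A < 1`), the deleted Euler logarithm
`Σ_{p deleted} Σ_k p^{−kσ}/k` converges for every `σ > A` (so `Σ_{p deleted} p^{−σ} < ∞`: the deleted set has dimension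
`≤ A`).  Proof: `Φ = ζ/Z` (value `a⁻¹` at `1`) is holomorphic on `Re s > A` and equals `e^{G_D}` on `Re s > 2`
(`zeta_div_riemannZeta_eq`); Landau's theorem in the exponential form (`Landau.summable_of_differentiableOn_halfPlane_cexp`,
MV 2007 Thm 1.7 / Lemma 15.1).  RH-FREE: `ζ`'s own zeros are ZEROS of `Φ`, harmless — contrast the tree's RH-conditional
`subPrimeRealZeroDominance_holds`, which continues the INVERSE quotient `Z/ζ`. [cite: MontgomeryVaughan2007, Lemma 15.1] -/
theorem delLogSummable_of_zeroFree {P : BeurlingPrimes} {f : ℕ → ℕ} (hf : StrictMono f)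
    (hP : ∀ j : ℕ, P.prime j = (ratPrime (f j) : ℝ)) {a β : ℝ} (ha : 0 < a) (hβ1 : β < 1)
    (hN : P.IntErrorLE a β) {Z : ℂ → ℂ} (hZ : P.IsZetaContinuation β Z) {A : ℝ} (hA : β ≤ A) (hA1 : A < 1)
    (hfree : ∀ s : ℂ, A < s.re → s ≠ 1 → Z s ≠ 0) {σ : ℝ} (hσ : A < σ) : DelLogSummable f σ := by
  obtain ⟨hsumP, Z₀, hZ₀, ⟨E₀, hE₀, hZ₀E⟩, -, -⟩ :=
    MontgomeryVaughan2007_zetaContinuation_holds P a β ha hβ1 hN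
  have heq : EqOn Z Z₀ {s : ℂ | β < s.re ∧ s ≠ 1} := hZ.eqOn hZ₀
  have hZform : ∀ s : ℂ, β < s.re → s ≠ 1 → Z s = a * s / (s - 1) + E₀ s :=
    fun s hs hs1 ↦ (heq ⟨hs, hs1⟩).trans (hZ₀E s hs hs1)
  -- the quotient `Φ = ζ/Z`, value `a⁻¹` at `1`
  set Φ : ℂ → ℂ := Function.update (fun s ↦ riemannZeta s / Z s) 1 ((a : ℂ)⁻¹) with hΦ
  have hΦ_ne : ∀ s : ℂ, s ≠ 1 → Φ s = riemannZeta s / Z s := fun s hs ↦ by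
    rw [hΦ, Function.update_of_ne hs]
  have hOβ : IsOpen {s : ℂ | β < s.re ∧ s ≠ 1} :=
    (isOpen_lt continuous_const Complex.continuous_re).inter isOpen_ne
  have hO : IsOpen {s : ℂ | A < s.re} := isOpen_lt continuous_const Complex.continuous_re
  -- holomorphy off `1`
  have hdiff' : DifferentiableOn ℂ Φ ({s : ℂ | A < s.re} \ {1}) := by
    have h1 : DifferentiableOn ℂ (fun s ↦ riemannZeta s / Z s) ({s : ℂ | A < s.re} \ {1}) := by
      intro s hs
      have hs1 : A < s.re := hs.1
      have hs2 : s ≠ 1 := hs.2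
      have hZd : DifferentiableAt ℂ Z s :=
        hZ.2.differentiableAt (hOβ.mem_nhds ⟨lt_of_le_of_lt hA hs1, hs2⟩)
      exact ((differentiableAt_riemannZeta hs2).div hZd (hfree s hs1 hs2)).differentiableWithinAt
    exact h1.congr fun s hs ↦ hΦ_ne s hs.2
  -- continuity at `1`: `(s−1)ζ(s) → 1`, `(s−1)Z(s) → a`
  have hcont : ContinuousAt Φ 1 := by
    rw [hΦ, continuousAt_update_same]
    have hE₀c : ContinuousAt E₀ 1 :=
      (hE₀.differentiableAt ((isOpen_lt continuous_const Complex.continuous_re).mem_nhds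
        (by simp only [Set.mem_setOf_eq, one_re]; linarith))).continuousAt
    have h2 : Tendsto (fun s : ℂ ↦ (a : ℂ) * s + (s - 1) * E₀ s) (𝓝 1)
        (𝓝 ((a : ℂ) * 1 + (1 - 1) * E₀ 1)) :=
      (tendsto_const_nhds.mul tendsto_id).add ((tendsto_id.sub tendsto_const_nhds).mul hE₀c.tendsto)
    rw [mul_one, sub_self, zero_mul, add_zero] at h2
    have hnear : ∀ᶠ s in 𝓝[≠] (1 : ℂ), β < s.re ∧ s ≠ 1 := by
      have h1 : ∀ᶠ s in 𝓝 (1 : ℂ), β < s.re :=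
        (isOpen_lt continuous_const Complex.continuous_re).mem_nhds
          (by simp only [Set.mem_setOf_eq, one_re]; linarith)
      exact (h1.filter_mono nhdsWithin_le_nhds).and self_mem_nhdsWithin
    have hden : Tendsto (fun s ↦ (s - 1) * Z s) (𝓝[≠] 1) (𝓝 (a : ℂ)) := by
      refine (h2.mono_left nhdsWithin_le_nhds).congr' ?_
      filter_upwards [hnear] with s hs
      rw [hZform s hs.1 hs.2]
      have : s - 1 ≠ 0 := sub_ne_zero.2 hs.2
      field_simp
    have ha' : (a : ℂ) ≠ 0 := by exact_mod_cast ha.ne'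
    have hq := riemannZeta_residue_one.div hden ha'
    rw [one_div] at hq
    refine hq.congr' ?_
    filter_upwards [self_mem_nhdsWithin] with s hs
    exact mul_div_mul_left _ _ (sub_ne_zero.2 hs)
  have hΦd : DifferentiableOn ℂ Φ {s : ℂ | A < s.re} :=
    (Complex.differentiableOn_compl_singleton_and_continuousAt_iff
      (hO.mem_nhds (by simp only [Set.mem_setOf_eq, one_re]; exact hA1))).1 ⟨hdiff', hcont⟩
  -- agreement with `exp(+G_D)` far to the right: `ζ/ζ_P = (ζ_P/ζ)⁻¹ = e^{G_D}`
  have hagree : EqOn Φ (fun s ↦ Complex.exp (Landau.genDirichlet (delCoeff f) (delFreq f) s))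
      {s : ℂ | 2 < s.re} := by
    intro s hs
    have hs' : (2 : ℝ) < s.re := hs
    have hs1 : s ≠ 1 := fun h ↦ by rw [h, one_re] at hs'; linarith
    show Φ s = _
    rw [hΦ_ne s hs1, hZ.1 s (by linarith), ← inv_div, zeta_div_riemannZeta_eq hf hP hs', ← Complex.exp_neg, neg_neg]
  exact Landau.summable_of_differentiableOn_halfPlane_cexp (delCoeff_nonneg' f) (delFreq_nonneg' f)
    (delLogSummable_two f) hΦd hagree hσ

/-- **Contrapositive (RH-free): DIMENSION FORCES ZEROS.**  If the deleted Euler logarithm DIVERGES at some `σ₀ > A`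
(`β ≤ A < 1`) — the deleted set has dimension `> A` — then every continuation `Z` of `ζ_P` VANISHES somewhere in the
open strip `A < Re s < 1` (zeros with `Re s ≥ 1` are excluded by the Euler product and `ζ_P(1+it) ≠ 0`,
`MontgomeryVaughan2007_eq_8_49_holds`).  Which of these zeros are NEW is decided by Lemma B: all of them right of the
deleted abscissa are zeros of `ζ`; so under RH every forced zero with `Re s > 1/2` is new, and unconditionally the
forced zeros are new wherever `ζ ≠ 0`. [cite: MontgomeryVaughan2007, Lemma 15.1] -/
theorem exists_zero_of_not_delLogSummable {P : BeurlingPrimes} {f : ℕ → ℕ} (hf : StrictMono f)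
    (hP : ∀ j : ℕ, P.prime j = (ratPrime (f j) : ℝ)) {a β : ℝ} (ha : 0 < a) (hβ1 : β < 1)
    (hN : P.IntErrorLE a β) {Z : ℂ → ℂ} (hZ : P.IsZetaContinuation β Z) {A σ₀ : ℝ} (hA : β ≤ A) (hA1 : A < 1)
    (hAσ : A < σ₀) (hdiv : ¬ DelLogSummable f σ₀) : ∃ s : ℂ, A < s.re ∧ s.re < 1 ∧ Z s = 0 := by
  by_contra hcon
  push Not at hcon
  obtain ⟨hsumP, -⟩ := MontgomeryVaughan2007_zetaContinuation_holds P a β ha hβ1 hN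
  refine hdiv (delLogSummable_of_zeroFree hf hP ha hβ1 hN hZ hA hA1 (fun s hs hs1 h0 ↦ ?_) hAσ)
  rcases lt_trichotomy s.re 1 with hlt | heq1 | hgt
  · exact hcon s hs hlt h0
  · -- on the line `Re s = 1`, `s ≠ 1`: MV (8.49)
    have ht : s.im ≠ 0 := fun him ↦ hs1 (Complex.ext (by simp [heq1]) (by simp [him]))
    have hs' : s = 1 + (s.im : ℂ) * I := Complex.ext (by simp [heq1]) (by simp)
    exact MontgomeryVaughan2007_eq_8_49_holds P a β ha hβ1 hN Z hZ s.im ht (hs' ▸ h0)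
  · -- `Re s > 1`: Euler product
    rw [hZ.1 s hgt] at h0
    exact P.zeta_ne_zero (by linarith) (hsumP s.re hgt) h0

/-- Under RH the forced zeros right of `1/2` are NEW (`ζ ≠ 0` off the critical line). [folklore] -/
private theorem exists_new_zero_of_not_delLogSummable_of_riemannHypothesis (hRH : RiemannHypothesis) {P : BeurlingPrimes}
    {f : ℕ → ℕ} (hf : StrictMono f) (hP : ∀ j : ℕ, P.prime j = (ratPrime (f j) : ℝ)) {a β : ℝ} (ha : 0 < a)
    (hβ1 : β < 1) (hN : P.IntErrorLE a β) {Z : ℂ → ℂ} (hZ : P.IsZetaContinuation β Z) {A σ₀ : ℝ} (hA : β ≤ A)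
    (hAhalf : 1 / 2 ≤ A) (hA1 : A < 1) (hAσ : A < σ₀) (hdiv : ¬ DelLogSummable f σ₀) :
    ∃ s : ℂ, A < s.re ∧ s.re < 1 ∧ Z s = 0 ∧ riemannZeta s ≠ 0 := by
  obtain ⟨s, hs, hs1, h0⟩ := exists_zero_of_not_delLogSummable hf hP ha hβ1 hN hZ hA hA1 hAσ hdiv
  exact ⟨s, hs, hs1, h0, riemannZeta_ne_zero_of_riemannHypothesis hRH (by linarith) (by linarith)⟩

/-! ## The LOG-DIMENSION form of reading R2 and its kernel bridges to the NEW-zero form -/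

/-- R2(a′), the log-dimension form: deleting a set of primes whose Euler logarithm diverges at every `σ < α`
(log-dimension `≥ α`) costs integer error exponent `β ≥ β₀`.  (The ψ-form `DimCost` and this form differ by partial
summation only: `ψ − ψ_P = O(x^σ) ⟹ Σ_{p deleted} p^{−σ'} < ∞ (σ' > σ)` and conversely — not typed here.) [cite: MontgomeryVaughan2007, Lemma 15.1] -/
def DimCostLog (α β₀ : ℝ) : Prop :=
  ∀ (P : BeurlingPrimes) (f : ℕ → ℕ) (a β : ℝ), StrictMono f → (∀ j : ℕ, P.prime j = (ratPrime (f j) : ℝ)) →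
    (∀ σ : ℝ, σ < α → ¬ DelLogSummable f σ) → 0 < a → P.IntErrorLE a β → β₀ ≤ β

/-- **(a′) ⟹ (b), RH-free (kernel Lemma B):** a NEW zero at `Re ρ ≥ α` exhibits log-dimension `≥ α`. [cite: MontgomeryVaughan2007, Lemma 15.1] -/
theorem newZeroCost_of_dimCostLog {α β₀ : ℝ} (h : DimCostLog α β₀) : NewZeroCost α β₀ := by
  intro P f a β Z ρ hf hP ha hN hZ hβρ hαρ hρ1 h0 hζ
  exact h P f a β hf hP (fun σ hσ ↦ not_delLogSummable_of_new_zero hf hP hZ hβρ hρ1 h0 hζ (lt_of_lt_of_le hσ hαρ))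
    ha hN

/-- **(b) at `α` ⟹ (a′) at every `α' > α`, under RH (kernel Lemma A; RH only certifies that the forced zero is NEW):**
for `1/2 ≤ α < α' ≤ 1`… precisely `1/2 ≤ α`, `α < α'`, `α < 1`, `β₀ ≤ α`. [folklore] -/
private theorem dimCostLog_of_newZeroCost_of_riemannHypothesis (hRH : RiemannHypothesis) {α α' β₀ : ℝ}
    (hαhalf : 1 / 2 ≤ α) (hα1 : α < 1) (hαα : α < α') (hβ₀α : β₀ ≤ α) (h : NewZeroCost α β₀) :
    DimCostLog α' β₀ := by
  intro P f a β hf hP hdiv ha hN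
  by_cases hβ : β₀ ≤ β
  · exact hβ
  have hβα : β < α := lt_of_lt_of_le (not_le.1 hβ) hβ₀α
  obtain ⟨-, Z, hZ, -⟩ := MontgomeryVaughan2007_zetaContinuation_holds P a β ha (by linarith) hN
  -- a divergence point strictly between `α` and `α'`
  set σ₀ : ℝ := (α + α') / 2 with hσ₀
  have hσ₀α : α < σ₀ := by rw [hσ₀]; linarith
  have hσ₀α' : σ₀ < α' := by rw [hσ₀]; linarith
  obtain ⟨s, hs, hs1, h0, hζ⟩ := exists_new_zero_of_not_delLogSummable_of_riemannHypothesis hRH hf hP ha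
    (by linarith) hN hZ hβα.le hαhalf hα1 hσ₀α (hdiv σ₀ hσ₀α')
  exact h P f a β Z s hf hP ha hN hZ (by linarith) hs.le hs1 h0 hζ

/-- So under RH the NEW-zero floor and the log-dimension floor coincide up to the endpoint, and BOTH obey the BDR edge:
`DimCostLog α β₀` fails for `β₀ > 2α/(α+2)`, `1/2 < α < 2/3` (RH; the BDR deleted set has log-dimension `≥ α`
BECAUSE it carries the new zero at `α` — kernel Lemma B, no prime-counting needed). [cite: BrouckeDebruyneRevesz2023, Theorem 1.3] -/
theorem not_dimCostLog_of_riemannHypothesis (hRH : RiemannHypothesis) {α β₀ : ℝ} (hα : 1 / 2 < α)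
    (hα23 : α < 2 / 3) (hβ₀ : 2 * α / (α + 2) < β₀) : ¬ DimCostLog α β₀ := fun h ↦
  not_newZeroCost_of_riemannHypothesis hRH hα hα23 hβ₀ (newZeroCost_of_dimCostLog h)

/-! ## v2 — PARTIAL SUMMATION (kernel): ψ-dimension `≤ α` ⟹ the deleted Euler log converges right of `α`.
This turns `NewZeroNeedsDim` (restricted to `0 ≤ α`) into a THEOREM, so the ψ-form T6 and the NEW-zero form are
linked with NO hypothesis in the direction (a) ⟹ (b), and RH refutes T6 above the BDR edge in kernel. -/

/-- The index bijection `(j, k) ↦ (f j, k)` of `ℕ × ℕ` onto the kept indices. [folklore] -/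
private def keptProdEquiv {f : ℕ → ℕ} (hf : StrictMono f) :
    ℕ × ℕ ≃ {jk : ℕ × ℕ // jk ∈ {jk : ℕ × ℕ | jk.1 ∈ Set.range f}} :=
  Equiv.ofBijective (fun jk ↦ ⟨(f jk.1, jk.2), ⟨jk.1, rfl⟩⟩)
    ⟨fun a b hab ↦ by
      have h := Subtype.ext_iff.mp hab
      simp only [Prod.mk.injEq] at h
      exact Prod.ext (hf.injective h.1) h.2,
     fun q ↦ by
      obtain ⟨j, hj⟩ := (q.2 : q.1.1 ∈ Set.range f)
      refine ⟨(j, q.1.2), Subtype.ext ?_⟩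
      simp [hj]⟩

/-- `ψ_P = psiOn (range f)` for a kept system `λ_j = q_{f j}`. [folklore] -/
private theorem chebyshevPsi_kept {P : BeurlingPrimes} {f : ℕ → ℕ} (hf : StrictMono f)
    (hP : ∀ j : ℕ, P.prime j = (ratPrime (f j) : ℝ)) (x : ℝ) :
    P.chebyshevPsi x = ratPrimes.psiOn (Set.range f) x := by
  rw [BeurlingPrimes.chebyshevPsi_eq_tsum, BeurlingPrimes.psiOn, ← tsum_subtype,
    ← Equiv.tsum_eq (keptProdEquiv hf)]
  refine tsum_congr fun jk ↦ ?_
  simp only [keptProdEquiv, Equiv.ofBijective_apply, BeurlingPrimes.psiTerm, hP, ratPrimes_prime]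

/-- `ψ_ℙ − ψ_P = psiOn (range f)ᶜ` — the deleted part of `ψ`. [folklore] -/
private theorem psi_sub_psi_kept {P : BeurlingPrimes} {f : ℕ → ℕ} (hf : StrictMono f)
    (hP : ∀ j : ℕ, P.prime j = (ratPrime (f j) : ℝ)) (x : ℝ) :
    ratPrimes.chebyshevPsi x - P.chebyshevPsi x = ratPrimes.psiOn (Set.range f)ᶜ x := by
  rw [chebyshevPsi_kept hf hP, ← ratPrimes.psiOn_add_psiOn_compl (Set.range f) x]
  ring

/-- **Partial summation (dyadic blocks).**  If the deleted `ψ` satisfies `ψ_ℙ(y) − ψ_P(y) ≤ C y^α + D` for all `y ≥ 1`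
(`C, D ≥ 0`, `0 ≤ α`), then the deleted Euler logarithm converges at every `σ > α`. [folklore] -/
private theorem delLogSummable_of_psiOn_le {f : ℕ → ℕ} {C D α σ : ℝ} (hC : 0 ≤ C) (hD : 0 ≤ D) (hα : 0 ≤ α)
    (hσ : α < σ) (hψ : ∀ y : ℝ, 1 ≤ y → ratPrimes.psiOn (Set.range f)ᶜ y ≤ C * y ^ α + D) :
    DelLogSummable f σ := by
  classical
  have hσ0 : 0 < σ := lt_of_le_of_lt hα hσ
  have hlog2 : 0 < Real.log 2 := Real.log_pos (by norm_num)
  -- the comparison family on `ℕ × ℕ` and the dyadic block index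
  set w : ℕ × ℕ → ℝ := fun jk ↦
    Real.log (ratPrime jk.1) * Real.exp (-(((jk.2 : ℝ) + 1) * Real.log (ratPrime jk.1) * σ)) with hw
  set L : ℕ × ℕ → ℕ := fun jk ↦ Nat.log 2 (ratPrime jk.1 ^ (jk.2 + 1)) with hL
  -- geometric majorant of the blocks
  set r₁ : ℝ := Real.exp ((α - σ) * Real.log 2) with hr₁
  set r₂ : ℝ := Real.exp (-(σ * Real.log 2)) with hr₂
  have hr₁0 : 0 ≤ r₁ := (Real.exp_pos _).le
  have hr₂0 : 0 ≤ r₂ := (Real.exp_pos _).le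
  have hr₁1 : r₁ < 1 := by
    rw [hr₁]; exact Real.exp_lt_one_iff.2 (mul_neg_of_neg_of_pos (by linarith) hlog2)
  have hr₂1 : r₂ < 1 := by
    rw [hr₂]; exact Real.exp_lt_one_iff.2 (by nlinarith)
  set g : ℕ → ℝ := fun m ↦ C * Real.exp (α * Real.log 2) * r₁ ^ m + D * r₂ ^ m with hg
  have hg0 : ∀ m, 0 ≤ g m := fun m ↦ by rw [hg]; positivity
  have hgs : Summable g :=
    ((summable_geometric_of_lt_one hr₁0 hr₁1).mul_left _).add
      ((summable_geometric_of_lt_one hr₂0 hr₂1).mul_left _)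
  -- block estimate: the block `L = m` of any finite set of DELETED indices weighs at most `g m`
  have hblock : ∀ (u : Finset (ℕ × ℕ)), (∀ jk ∈ u, jk.1 ∉ Set.range f) → ∀ m : ℕ,
      ∑ jk ∈ u with L jk = m, w jk ≤ g m := by
    intro u hu m
    have h2m : (0 : ℝ) < (2 : ℝ) ^ m := by positivity
    -- each term: `w jk ≤ log p · exp(−m log 2 · σ)` and the log-part is a term of `psiOn (range f)ᶜ (2^(m+1))`
    have hterm : ∀ jk ∈ u.filter (fun jk ↦ L jk = m),
        w jk ≤ Real.exp (-(m * Real.log 2 * σ)) *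
          {jk : ℕ × ℕ | jk.1 ∈ (Set.range f)ᶜ}.indicator (ratPrimes.psiTerm ((2 : ℝ) ^ (m + 1))) jk := by
      intro jk hjk
      rw [Finset.mem_filter] at hjk
      obtain ⟨hjku, hLm⟩ := hjk
      have hp2 : 2 ≤ ratPrime jk.1 := (prime_ratPrime jk.1).two_le
      have hpR : (2 : ℝ) ≤ (ratPrime jk.1 : ℝ) := by exact_mod_cast hp2
      have hq0 : ratPrime jk.1 ^ (jk.2 + 1) ≠ 0 := pow_ne_zero _ (by omega)
      have hlow : (2 : ℕ) ^ m ≤ ratPrime jk.1 ^ (jk.2 + 1) := by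
        have := Nat.pow_log_le_self 2 hq0
        rwa [show Nat.log 2 (ratPrime jk.1 ^ (jk.2 + 1)) = m from hLm] at this
      have hup : ratPrime jk.1 ^ (jk.2 + 1) ≤ 2 ^ (m + 1) := by
        have := Nat.lt_pow_succ_log_self (b := 2) (by norm_num) (ratPrime jk.1 ^ (jk.2 + 1))
        rw [show Nat.log 2 (ratPrime jk.1 ^ (jk.2 + 1)) = m from hLm] at this
        exact this.le
      have hlowR : (2 : ℝ) ^ m ≤ (ratPrime jk.1 : ℝ) ^ (jk.2 + 1) := by exact_mod_cast hlow
      have hupR : (ratPrime jk.1 : ℝ) ^ (jk.2 + 1) ≤ (2 : ℝ) ^ (m + 1) := by exact_mod_cast hup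
      have hlogp : 0 ≤ Real.log (ratPrime jk.1 : ℝ) := Real.log_nonneg (by linarith)
      -- the indicator term equals `log p`
      have hind : {jk : ℕ × ℕ | jk.1 ∈ (Set.range f)ᶜ}.indicator (ratPrimes.psiTerm ((2 : ℝ) ^ (m + 1))) jk
          = Real.log (ratPrime jk.1 : ℝ) := by
        rw [Set.indicator_of_mem (show jk ∈ {jk : ℕ × ℕ | jk.1 ∈ (Set.range f)ᶜ} from hu jk hjku)]
        simp only [BeurlingPrimes.psiTerm, ratPrimes_prime]
        rw [if_pos hupR]
      rw [hind, hw]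
      simp only
      rw [mul_comm (Real.exp _) (Real.log _)]
      refine mul_le_mul_of_nonneg_left (Real.exp_le_exp.2 ?_) hlogp
      -- `m log 2 ≤ (k+1) log p`
      have hml : (m : ℝ) * Real.log 2 ≤ ((jk.2 : ℝ) + 1) * Real.log (ratPrime jk.1 : ℝ) := by
        have h1 : Real.log ((2 : ℝ) ^ m) ≤ Real.log ((ratPrime jk.1 : ℝ) ^ (jk.2 + 1)) :=
          Real.log_le_log h2m hlowR
        rw [Real.log_pow, Real.log_pow] at h1
        push_cast at h1
        linarith
      nlinarith
    calc ∑ jk ∈ u with L jk = m, w jk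
        ≤ ∑ jk ∈ u with L jk = m, Real.exp (-(m * Real.log 2 * σ)) *
            {jk : ℕ × ℕ | jk.1 ∈ (Set.range f)ᶜ}.indicator (ratPrimes.psiTerm ((2 : ℝ) ^ (m + 1))) jk :=
          Finset.sum_le_sum hterm
      _ = Real.exp (-(m * Real.log 2 * σ)) * ∑ jk ∈ u with L jk = m,
            {jk : ℕ × ℕ | jk.1 ∈ (Set.range f)ᶜ}.indicator (ratPrimes.psiTerm ((2 : ℝ) ^ (m + 1))) jk := by
          rw [Finset.mul_sum]
      _ ≤ Real.exp (-(m * Real.log 2 * σ)) * ratPrimes.psiOn (Set.range f)ᶜ ((2 : ℝ) ^ (m + 1)) := by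
          refine mul_le_mul_of_nonneg_left ?_ (Real.exp_pos _).le
          exact (summable_indicator_psiTerm ratPrimes (Set.range f)ᶜ _).sum_le_tsum _
            fun jk _ ↦ indicator_psiTerm_nonneg ratPrimes (Set.range f)ᶜ _ jk
      _ ≤ Real.exp (-(m * Real.log 2 * σ)) * (C * ((2 : ℝ) ^ (m + 1)) ^ α + D) :=
          mul_le_mul_of_nonneg_left (hψ _ (one_le_pow₀ (by norm_num))) (Real.exp_pos _).le
      _ = g m := by
          have e1 : ((2 : ℝ) ^ (m + 1)) ^ α = Real.exp (((m : ℝ) + 1) * Real.log 2 * α) := by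
            rw [Real.rpow_def_of_pos (by positivity), Real.log_pow]; congr 1; push_cast; ring
          have e2 : r₁ ^ m = Real.exp (m * ((α - σ) * Real.log 2)) := by rw [hr₁, ← Real.exp_nat_mul]
          have e3 : r₂ ^ m = Real.exp (m * (-(σ * Real.log 2))) := by rw [hr₂, ← Real.exp_nat_mul]
          have e4 : Real.exp (-(m * Real.log 2 * σ)) * Real.exp (((m : ℝ) + 1) * Real.log 2 * α)
              = Real.exp (α * Real.log 2) * Real.exp (m * ((α - σ) * Real.log 2)) := by
            rw [← Real.exp_add, ← Real.exp_add]; congr 1; ring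
          have e5 : Real.exp (-(m * Real.log 2 * σ)) = Real.exp (m * (-(σ * Real.log 2))) := by
            congr 1; ring
          rw [hg]; simp only; rw [e1, e2, e3]; linear_combination C * e4 + D * e5
  -- the whole finite sum over deleted indices is bounded by `∑ g`
  have hsum : ∀ (u : Finset (ℕ × ℕ)), (∀ jk ∈ u, jk.1 ∉ Set.range f) → ∑ jk ∈ u, w jk ≤ ∑' m, g m := by
    intro u hu
    rw [← Finset.sum_fiberwise_of_maps_to (fun jk hjk ↦ Finset.mem_image_of_mem L hjk) w]
    calc ∑ m ∈ u.image L, ∑ jk ∈ u with L jk = m, w jk ≤ ∑ m ∈ u.image L, g m :=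
          Finset.sum_le_sum fun m _ ↦ hblock u hu m
      _ ≤ ∑' m, g m := hgs.sum_le_tsum _ fun m _ ↦ hg0 m
  -- transfer to the deleted index type
  have hF0 : 0 ≤ fun i : ↥(Set.range f)ᶜ × ℕ ↦ delCoeff f i * Real.exp (-(delFreq f i * σ)) :=
    fun i ↦ mul_nonneg (delCoeff_nonneg' f i) (Real.exp_pos _).le
  set ι : ↥(Set.range f)ᶜ × ℕ → ℕ × ℕ := fun i ↦ ((i.1 : ℕ), i.2) with hι
  have hιinj : Function.Injective ι := by
    intro a b hab
    simp only [hι, Prod.mk.injEq] at hab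
    exact Prod.ext (Subtype.ext hab.1) hab.2
  have hle : ∀ i : ↥(Set.range f)ᶜ × ℕ,
      delCoeff f i * Real.exp (-(delFreq f i * σ)) ≤ (Real.log 2)⁻¹ * w (ι i) := by
    intro i
    have hp2 : (2 : ℝ) ≤ (ratPrime (i.1 : ℕ) : ℝ) := by exact_mod_cast (prime_ratPrime (i.1 : ℕ)).two_le
    have hlogp : Real.log 2 ≤ Real.log (ratPrime (i.1 : ℕ) : ℝ) := Real.log_le_log (by norm_num) hp2
    have hcoef : delCoeff f i ≤ 1 := by
      simp only [delCoeff]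
      rw [div_le_one (by positivity)]
      linarith [(Nat.cast_nonneg i.2 : (0 : ℝ) ≤ i.2)]
    have hE : Real.exp (-(delFreq f i * σ)) =
        Real.exp (-((((i.2 : ℕ) : ℝ) + 1) * Real.log (ratPrime (i.1 : ℕ)) * σ)) := by
      simp only [delFreq]
    have h1 : (1 : ℝ) ≤ (Real.log 2)⁻¹ * Real.log (ratPrime (i.1 : ℕ) : ℝ) := by
      rw [inv_mul_eq_div, le_div_iff₀ hlog2]; linarith
    rw [hE, hw]
    simp only [hι]
    calc delCoeff f i * Real.exp (-(((i.2 : ℝ) + 1) * Real.log (ratPrime (i.1 : ℕ) : ℝ) * σ))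
        ≤ 1 * Real.exp (-(((i.2 : ℝ) + 1) * Real.log (ratPrime (i.1 : ℕ) : ℝ) * σ)) :=
          mul_le_mul_of_nonneg_right hcoef (Real.exp_pos _).le
      _ ≤ ((Real.log 2)⁻¹ * Real.log (ratPrime (i.1 : ℕ) : ℝ)) *
            Real.exp (-(((i.2 : ℝ) + 1) * Real.log (ratPrime (i.1 : ℕ) : ℝ) * σ)) :=
          mul_le_mul_of_nonneg_right h1 (Real.exp_pos _).le
      _ = _ := by ring
  refine summable_of_sum_le hF0 (c := (Real.log 2)⁻¹ * ∑' m, g m) fun v ↦ ?_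
  have hv : ∀ jk ∈ v.map ⟨ι, hιinj⟩, jk.1 ∉ Set.range f := by
    intro jk hjk
    rw [Finset.mem_map] at hjk
    obtain ⟨i, -, rfl⟩ := hjk
    exact i.1.2
  calc ∑ i ∈ v, delCoeff f i * Real.exp (-(delFreq f i * σ))
      ≤ ∑ i ∈ v, (Real.log 2)⁻¹ * w (ι i) := Finset.sum_le_sum fun i _ ↦ hle i
    _ = (Real.log 2)⁻¹ * ∑ jk ∈ v.map ⟨ι, hιinj⟩, w jk := by
        rw [Finset.mul_sum, Finset.sum_map]; rfl
    _ ≤ (Real.log 2)⁻¹ * ∑' m, g m :=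
        mul_le_mul_of_nonneg_left (hsum _ hv) (inv_nonneg.2 hlog2.le)

/-- **`NewZeroNeedsDim` is a theorem for `0 ≤ α` (kernel, RH-free):** a NEW zero `ρ` of a kept zeta function
(`β < Re ρ < 1`) forces `ψ_ℙ − ψ_P ≥ c·x^α` for unboundedly many `x`, for every `0 ≤ α < Re ρ` and EVERY `c > 0`
(Lemma B `not_delLogSummable_of_new_zero` + partial summation `delLogSummable_of_psiOn_le`). [folklore] -/
private theorem frequently_psi_sub_ge_of_new_zero {P : BeurlingPrimes} {f : ℕ → ℕ} (hf : StrictMono f)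
    (hP : ∀ j : ℕ, P.prime j = (ratPrime (f j) : ℝ)) {β : ℝ} {Z : ℂ → ℂ} (hZ : P.IsZetaContinuation β Z)
    {ρ : ℂ} (hβρ : β < ρ.re) (hρ1 : ρ.re < 1) (h0 : Z ρ = 0) (hζ : riemannZeta ρ ≠ 0)
    {α : ℝ} (hα0 : 0 ≤ α) (hα : α < ρ.re) {c : ℝ} (hc : 0 < c) :
    ∃ᶠ x in atTop, c * x ^ α ≤ ratPrimes.chebyshevPsi x - P.chebyshevPsi x := by
  by_contra hcon
  rw [Filter.not_frequently] at hcon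
  obtain ⟨y₀, hy₀⟩ := Filter.eventually_atTop.1 hcon
  set y₁ : ℝ := max y₀ 1 with hy₁
  set D : ℝ := ratPrimes.psiOn (Set.range f)ᶜ y₁ with hDdef
  have hD : 0 ≤ D := ratPrimes.psiOn_nonneg (Set.range f)ᶜ y₁
  have hψ : ∀ y : ℝ, 1 ≤ y → ratPrimes.psiOn (Set.range f)ᶜ y ≤ c * y ^ α + D := by
    intro y hy
    have hyα : 0 ≤ c * y ^ α := mul_nonneg hc.le (Real.rpow_nonneg (by linarith) _)
    rcases le_or_gt y₀ y with hle | hlt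
    · have h := hy₀ y hle
      rw [psi_sub_psi_kept hf hP, not_le] at h
      linarith
    · have hmono := ratPrimes.psiOn_mono (Set.range f)ᶜ (show y ≤ y₁ from le_trans hlt.le (le_max_left _ _))
      linarith
  have hsum := delLogSummable_of_psiOn_le hc.le hD hα0 (σ := (α + ρ.re) / 2) (by linarith) hψ
  exact not_delLogSummable_of_new_zero hf hP hZ hβρ hρ1 h0 hζ (σ₀ := (α + ρ.re) / 2) (by linarith) hsum

/-- Hence the bridge (a) ⟹ (b) needs NO hypothesis: `DimCost α₁ β₀ → NewZeroCost α β₀` for `0 ≤ α₁ < α`. [cite: MontgomeryVaughan2007, Lemma 15.1] -/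
theorem newZeroCost_of_dimCost' {α₁ α β₀ : ℝ} (hα₁ : 0 ≤ α₁) (hα : α₁ < α) (h : DimCost α₁ β₀) :
    NewZeroCost α β₀ := by
  intro P f a β Z ρ hf hP ha hN hZ hβρ hαρ hρ1 h0 hζ
  exact h P f a β hf hP ⟨1, one_pos, frequently_psi_sub_ge_of_new_zero hf hP hZ hβρ hρ1 h0 hζ hα₁
    (by linarith) one_pos⟩ ha hN

/-- T6 ⟹ the NEW-zero floor, unconditionally: `DeletionUncertainty → ∀ α ∈ (1/2,1), ∃ β₀ > 0, NewZeroCost α β₀`. [cite: MontgomeryVaughan2007, Lemma 15.1] -/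
theorem newZeroCost_of_deletionUncertainty (hT : DeletionUncertainty) {α : ℝ} (hα : 1 / 2 < α) (hα1 : α < 1) :
    ∃ β₀ : ℝ, 0 < β₀ ∧ NewZeroCost α β₀ := by
  obtain ⟨β₀, hβ₀, hD⟩ := hT ((1 / 2 + α) / 2) (by linarith) (by linarith)
  exact ⟨β₀, hβ₀, newZeroCost_of_dimCost' (by linarith) (by linarith) hD⟩

/-- **RH refutes T6 above the BDR edge — kernel, no Props:** under RH, `DimCost α₁ β₀` fails whenever
`0 ≤ α₁ < α`, `1/2 < α < 2/3`, `β₀ > 2α/(α+2)` (the BDR kept system has a NEW real zero at `α`, so by Lemma B + partial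
summation its deleted ψ is `≥ x^{α₁}` frequently, while its integer error is `2α/(α+2) + ε < β₀`). In particular
`DeletionUncertainty`'s β₀(α₁) is `≤ 2α/(α+2)` for every `α > α₁`, i.e. `β₀(α₁) ≤ 2α₁/(α₁+2)` in the limit. [cite: BrouckeDebruyneRevesz2023, Theorem 1.3] -/
theorem not_dimCost_of_riemannHypothesis' (hRH : RiemannHypothesis) {α₁ α β₀ : ℝ} (hα₁0 : 0 ≤ α₁)
    (hα₁ : α₁ < α) (hα : 1 / 2 < α) (hα23 : α < 2 / 3) (hβ₀ : 2 * α / (α + 2) < β₀) : ¬ DimCost α₁ β₀ :=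
  fun h ↦ not_newZeroCost_of_riemannHypothesis hRH hα hα23 hβ₀ (newZeroCost_of_dimCost' hα₁0 hα₁ h)


/-- Under RH the ψ-form window is capped by the BDR edge, in kernel: `DimCost α₁ β₀` (`0 ≤ α₁ < α`, `1/2 < α < 2/3`)
forces `β₀ ≤ 2α/(α+2)`. [folklore] -/
private theorem dimCost_window_le_of_riemannHypothesis (hRH : RiemannHypothesis) {α₁ α β₀ : ℝ} (hα₁0 : 0 ≤ α₁)
    (hα₁ : α₁ < α) (hα : 1 / 2 < α) (hα23 : α < 2 / 3) (h : DimCost α₁ β₀) : β₀ ≤ 2 * α / (α + 2) :=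
  not_lt.1 fun hβ ↦ not_dimCost_of_riemannHypothesis' hRH hα₁0 hα₁ hα hα23 hβ h

end Literature.Barriers.RiemannHypothesis.DeletionWindow
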